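import Summits.CriticalPhenomena.PercolationContinuityZ3.Theorems.Transplant.SkelPhiNegReachReadC
import Summits.CriticalPhenomena.PercolationContinuityZ3.Theorems.Transplant.SkelPhiNegReachRoomsAB
import HarnessLib

/-!
# N1 (the `{±1}` node), (C) column file (C-S9d): THE ROOMS OF THE x-BAND (u-corridor, `du.1 = 0`) at the record values of RULING B.15 (S1) — for
# the windowed x-band `xPrmWw n ℓ h T n 799 q_y q_y` read in `runX φ c₀ n h 1` with the corridor sign `σ = sgOf du`: (§1) the corners of signed boxes
# about the origin and the band's corner values; (§2) **every region `j ≤ 799` reads inside the rooms** `−5r∥ + 1 ≤ · ≤ 22r∥ − 1` along (sign-split)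
# and `±(2r⊥ − 1)` across, from three BAND FLOORS `hbx1` (`Δ·(2n + 800T) + C + 3Δn ≤ 200·Δ·n`), `hbx2` (`Δ·(801n + 800T) + C + 3Δn ≤ 880·Δ·n`),
# `hbx3` (`U·(X₁ + 1) + 2Δ ≤ 80Δ`), `C := |v|·U·(X₁ + 1)`, `X₁ := q_y + 800T + Lb`; (§3) **the last core (`j = 800`) reads inside the arrival box
# `cen' ± (b₀ − 1)`** from the two TARGET FLOORS `hxL1` / `hxL3`; (§4) the habitat points `(σ·j·n, 0)` of the cores and their rooms.

builds on p205010 (kernel theorem, internal audit signed; external expert review pending) — nothing in this file uses p205010; nothing here is a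
claim about the open node `SamePDropOfSkeletonNeg`.
Lane `prim-bschramm`, seat `prim-bschramm-p5` (gen 9; (C) lineage); helper file (`--supports stmt-CriticalPhenomena-4575`).
[cite: KozmaNitzan2024, §4 Lemma 11 (pp. 22–23), Lemma 12 (pp. 23–25), p. 26 (M_v, H_{v,x})] [cite: MartineauTassion2017, §4.3 Lemma 4.2]
-/

noncomputable section

namespace Summit.CriticalPhenomena.PercolationContinuityZ3.Theorems

namespace Transplant

namespace Skelφ

open Literature.Probability.Percolation Literature.Probability.LatticeModels
open Literature.Probability.Percolation.KozmaNitzan.Cells (oth oth_ne sgOf sgOf_sign eq_oth_of_ne)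
open TwoAxis.Para (modulus)
open ChainPlanar ChainPara

/-! ## §1 Corners -/

/-- The corners of `dBox a (−1) 0 aLo aHi bLo bHi` on the axis and across. [folklore] -/
theorem dLoHi_neg_zero (a : Fin 2) (aLo aHi bLo bHi : ℤ) :
    dLo a (-1) 0 aLo aHi bLo bHi a = -aHi ∧ dLo a (-1) 0 aLo aHi bLo bHi (oth a) = -bHi ∧
      dHi a (-1) 0 aLo aHi bLo bHi a = -aLo ∧ dHi a (-1) 0 aLo aHi bLo bHi (oth a) = -bLo := by
  have h1 : (-1 : ℤ) ≠ 1 := by norm_num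
  simp only [dLo, dHi, if_true, if_neg (oth_ne a), if_neg h1, Pi.zero_apply, zero_sub, and_self]

namespace CorrRec

/-- `oth 0 = 1` on `Fin 2`. [folklore] -/
private theorem oth_zero' : oth (0 : Fin 2) = 1 := by decide

section XBand

variable {A : ℤ} {n : ℕ} {h v vβ c₀' c₁' D : ℤ} {P : PCells2} {ℓ T : ℕ} {aW bL : ℤ}
  (hn : 1 ≤ n) (hA : 0 < A) (hD : 0 < D) (hm : 0 < modulus n h v vβ) (hc₀ : 0 < c₀')
  (hsc0 : c₀' * A * (40 * modulus n h v vβ) = (P.r 0 : ℤ) * D) (hsc1 : c₁' * A * (40 * modulus n h v vβ) = (P.r 1 : ℤ) * D)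

/-- The x-band record of the corridor along a u-direction `du` (`du.1 = 0`). [folklore] -/
theorem bandNw_x {du : MDir} (hd : du.1 = 0) :
    bandNw n ℓ h v T n NC (qy n ℓ h v T aW bL) NC (qy n ℓ h v T aW bL) (Wmy n v) (Wpy n v) du =
      xPrmWw n ℓ h T n NC (qy n ℓ h v T aW bL) (qy n ℓ h v T aW bL) := by
  simp [bandNw, hd]

/-- **The corner values of the x-band record** at step `j`: along `[jn − n − jT − T − n, jn + n + jT + T + n]` (region), across
`±(q_y + jT + T + Lb)`; the core's are the same without `T + La / T + Lb`. [folklore] -/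
theorem cornersX (j : ℕ) :
    let R := xPrmWw n ℓ h T n NC (qy n ℓ h v T aW bL) (qy n ℓ h v T aW bL)
    R.aLo j = (j : ℤ) * n - n - j * T ∧ R.aHi j = (j : ℤ) * n + n + j * T ∧
      R.bLo j = -((qy n ℓ h v T aW bL : ℕ) + (j : ℤ) * T) ∧ R.bHi j = (qy n ℓ h v T aW bL : ℕ) + (j : ℤ) * T ∧
      (R.ea : ℤ) = T ∧ (R.eb : ℤ) = T ∧ (R.La : ℤ) = n ∧ (R.Lb : ℤ) = ((3 * (n * ℓ) / shearUnit n h + 1 : ℕ) : ℤ) ∧ R.N = 799 := by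
  refine ⟨?_, ?_, ?_, ?_, rfl, rfl, rfl, rfl, rfl⟩ <;> simp [xPrmWw, RunPrm.aLo, RunPrm.aHi, RunPrm.bLo, RunPrm.bHi]

/-! ## §2 The regions of the x-band -/

include hn hA hD hm hc₀ hsc0 hsc1 in
/-- **Every region of the x-band reads inside the rooms with one unit of margin**, either corridor sign, under the three band floors.
[cite: KozmaNitzan2024, §4 Lemma 11 (p. 22), Lemma 12 (pp. 23–25)] -/
theorem roomsBx
    (hbx1 : modulus n h v vβ * (2 * n + 800 * T) + |v| * ((shearUnit n h : ℤ) * ((qy n ℓ h v T aW bL : ℕ) + 800 * T + (3 * (n * ℓ) / shearUnit n h + 1 : ℕ) + 1))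
      + 3 * modulus n h v vβ * n ≤ 40 * 5 * modulus n h v vβ * n)
    (hbx2 : modulus n h v vβ * (801 * n + 800 * T) + |v| * ((shearUnit n h : ℤ) * ((qy n ℓ h v T aW bL : ℕ) + 800 * T + (3 * (n * ℓ) / shearUnit n h + 1 : ℕ) + 1))
      + 3 * modulus n h v vβ * n ≤ 40 * 22 * modulus n h v vβ * n)
    (hbx3 : (shearUnit n h : ℤ) * ((qy n ℓ h v T aW bL : ℕ) + 800 * T + (3 * (n * ℓ) / shearUnit n h + 1 : ℕ) + 1) + 2 * modulus n h v vβ ≤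
      40 * 2 * modulus n h v vβ)
    {du : MDir} (hd : du.1 = 0) {j : ℕ} (hj : j ≤ 799) :
    let Bd := bandNw n ℓ h v T n NC (qy n ℓ h v T aW bL) NC (qy n ℓ h v T aW bL) (Wmy n v) (Wpy n v) du
    let lo := dLo du.1 (sgOf du) 0 (Bd.aLo j - Bd.ea - Bd.La) (Bd.aHi j + Bd.ea + Bd.La) (Bd.bLo j - Bd.eb - Bd.Lb) (Bd.bHi j + Bd.eb + Bd.Lb)
    let hi := dHi du.1 (sgOf du) 0 (Bd.aLo j - Bd.ea - Bd.La) (Bd.aHi j + Bd.ea + Bd.La) (Bd.bLo j - Bd.eb - Bd.Lb) (Bd.bHi j + Bd.eb + Bd.Lb)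
    (sgOf du = 1 → -(5 * (P.r du.1 : ℤ)) + 1 ≤ rdLo A n h v vβ c₀' c₁' D lo hi du.1 ∧ rdHi A n h v vβ c₀' c₁' D lo hi du.1 ≤ 22 * (P.r du.1 : ℤ) - 1) ∧
    (sgOf du = -1 → -(5 * (P.r du.1 : ℤ)) + 1 ≤ -rdHi A n h v vβ c₀' c₁' D lo hi du.1 ∧ -rdLo A n h v vβ c₀' c₁' D lo hi du.1 ≤ 22 * (P.r du.1 : ℤ) - 1) ∧
    (-(2 * (P.r (oth du.1) : ℤ)) + 1 ≤ rdLo A n h v vβ c₀' c₁' D lo hi (oth du.1) ∧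
      rdHi A n h v vβ c₀' c₁' D lo hi (oth du.1) ≤ 2 * (P.r (oth du.1) : ℤ) - 1) := by
  intro Bd lo hi
  dsimp only [Bd, lo, hi]
  rw [bandNw_x (n := n) (ℓ := ℓ) (h := h) (v := v) (T := T) (aW := aW) (bL := bL) hd, hd, oth_zero']
  obtain ⟨haLo, haHi, hbLo, hbHi, hea, heb, hLa, hLb, -⟩ := cornersX (n := n) (h := h) (v := v) (ℓ := ℓ) (T := T) (aW := aW) (bL := bL) j
  set R := xPrmWw n ℓ h T n NC (qy n ℓ h v T aW bL) (qy n ℓ h v T aW bL) with hR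
  set X₁ : ℤ := (qy n ℓ h v T aW bL : ℕ) + 800 * T + (3 * (n * ℓ) / shearUnit n h + 1 : ℕ) with hX₁
  have hj' : (j : ℤ) ≤ 799 := by exact_mod_cast hj
  have hj0 : (0 : ℤ) ≤ j := by positivity
  have hT0 : (0 : ℤ) ≤ T := by positivity
  have hn0 : (0 : ℤ) ≤ n := by positivity
  have hq0 : (0 : ℤ) ≤ (qy n ℓ h v T aW bL : ℕ) := by positivity
  have hLb0 : (0 : ℤ) ≤ ((3 * (n * ℓ) / shearUnit n h + 1 : ℕ) : ℤ) := by positivity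
  have hjT : (j : ℤ) * T ≤ 799 * T := by nlinarith
  have hjn : (j : ℤ) * n ≤ 799 * n := by nlinarith
  have hjT0 : 0 ≤ (j : ℤ) * T := by positivity
  have hjn0 : 0 ≤ (j : ℤ) * n := by positivity
  -- the four corner magnitudes
  have cLo : -(2 * (n : ℤ) + 800 * T) ≤ R.aLo j - R.ea - R.La := by rw [haLo, hea, hLa]; linarith
  have cHi : R.aHi j + R.ea + R.La ≤ 801 * (n : ℤ) + 800 * T := by rw [haHi, hea, hLa]; linarith
  have cbL : |R.bLo j - R.eb - R.Lb| ≤ X₁ := by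
    rw [hbLo, heb, hLb, abs_le]; constructor <;> linarith
  have cbH : |R.bHi j + R.eb + R.Lb| ≤ X₁ := by
    rw [hbHi, heb, hLb, abs_le]; constructor <;> linarith
  have cbL' := abs_le.1 cbL
  have cbH' := abs_le.1 cbH
  have hb3' : (shearUnit n h : ℤ) * X₁ + 2 * modulus n h v vβ ≤ 40 * 2 * modulus n h v vβ := by
    have hU : (0 : ℤ) ≤ (shearUnit n h : ℤ) := by positivity
    linarith [hbx3]
  rcases sgOf_sign du with hs | hs <;> rw [hs]
  · -- sign `+1`
    obtain ⟨e0, e1, e0', e1'⟩ := dLoHi_one_zero 0 (R.aLo j - R.ea - R.La) (R.aHi j + R.ea + R.La) (R.bLo j - R.eb - R.Lb) (R.bHi j + R.eb + R.Lb)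
    rw [oth_zero'] at e1 e1'
    set lo' := dLo 0 1 0 (R.aLo j - R.ea - R.La) (R.aHi j + R.ea + R.La) (R.bLo j - R.eb - R.Lb) (R.bHi j + R.eb + R.Lb) with hlo'
    set hi' := dHi 0 1 0 (R.aLo j - R.ea - R.La) (R.aHi j + R.ea + R.La) (R.bLo j - R.eb - R.Lb) (R.bHi j + R.eb + R.Lb) with hhi'
    have g0l : -(2 * (n : ℤ) + 800 * T) ≤ lo' 0 := by rw [e0]; exact cLo
    have g0h : hi' 0 ≤ 801 * (n : ℤ) + 800 * T := by rw [e0']; exact cHi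
    have g1l : |lo' 1| ≤ X₁ := by rw [e1]; exact cbL
    have g1h : |hi' 1| ≤ X₁ := by rw [e1']; exact cbH
    have k1 := readLo0_of_budget (c₁' := c₁') hn hA hD hm hc₀ hsc0 (lo := lo') (hi := hi') (m := 5) g0l g1l g1h hbx1
    have k2 := readHi0_of_budget (A := A) (c₁' := c₁') hn hD hm hc₀ hsc0 (lo := lo') (hi := hi') (m := 22) g0h g1l g1h hbx2
    have k3 := readLo1_of_budget (A := A) (c₀' := c₀') hD hm hsc1 (lo := lo') (hi := hi') (m := 2) (B := X₁) (abs_le.1 g1l).1 hb3'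
    have k4 := readHi1_of_budget (A := A) (c₀' := c₀') hD hm hsc1 (lo := lo') (hi := hi') (m := 2) (B := X₁) (abs_le.1 g1h).2 hbx3
    exact ⟨fun _ => ⟨by linarith, by linarith⟩, fun h1 => absurd h1 (by norm_num), by linarith, by linarith⟩
  · -- sign `−1`
    obtain ⟨e0, e1, e0', e1'⟩ := dLoHi_neg_zero 0 (R.aLo j - R.ea - R.La) (R.aHi j + R.ea + R.La) (R.bLo j - R.eb - R.Lb) (R.bHi j + R.eb + R.Lb)
    rw [oth_zero'] at e1 e1'
    set lo' := dLo 0 (-1) 0 (R.aLo j - R.ea - R.La) (R.aHi j + R.ea + R.La) (R.bLo j - R.eb - R.Lb) (R.bHi j + R.eb + R.Lb) with hlo'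
    set hi' := dHi 0 (-1) 0 (R.aLo j - R.ea - R.La) (R.aHi j + R.ea + R.La) (R.bLo j - R.eb - R.Lb) (R.bHi j + R.eb + R.Lb) with hhi'
    have g0l : -(801 * (n : ℤ) + 800 * T) ≤ lo' 0 := by rw [e0]; linarith
    have g0h : hi' 0 ≤ 2 * (n : ℤ) + 800 * T := by rw [e0']; linarith
    have g1l : |lo' 1| ≤ X₁ := by rw [e1, abs_neg]; exact cbH
    have g1h : |hi' 1| ≤ X₁ := by rw [e1', abs_neg]; exact cbL
    have k1 := readHi0_of_budget (A := A) (c₁' := c₁') hn hD hm hc₀ hsc0 (lo := lo') (hi := hi') (m := 5) g0h g1l g1h hbx1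
    have k2 := readLo0_of_budget (c₁' := c₁') hn hA hD hm hc₀ hsc0 (lo := lo') (hi := hi') (m := 22) g0l g1l g1h hbx2
    have k3 := readLo1_of_budget (A := A) (c₀' := c₀') hD hm hsc1 (lo := lo') (hi := hi') (m := 2) (B := X₁) (abs_le.1 g1l).1 hb3'
    have k4 := readHi1_of_budget (A := A) (c₀' := c₀') hD hm hsc1 (lo := lo') (hi := hi') (m := 2) (B := X₁) (abs_le.1 g1h).2 hbx3
    exact ⟨fun h1 => absurd h1 (by norm_num), fun _ => ⟨by linarith, by linarith⟩, by linarith, by linarith⟩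

/-! ## §3 The last core of the x-band: the arrival box `cen' ± (b₀ − 1)` -/

/-- **The last core (`j = 800`) of the x-band reads inside the next cell's arrival box with one unit of margin**, either sign, under the three
target floors `hxL1` (`40Δn·(20r₀ − b₀ + 1) + r₀·n + r₀·C ≤ r₀·Δ·(799n − 800T)`, which also gives the upper reading) and
`hxL3` (`r₁·U·(q_y + 800T + 1) + 40Δ ≤ 40Δ·b₀⊥`), `C := |v|·U·(q_y + 800T + 1)`. [cite: KozmaNitzan2024, §4 Lemma 12 (pp. 23–25), p. 26 (M_v)] -/
theorem roomsLx (hn : 1 ≤ n) (hA : 0 < A) (hD : 0 < D) (hm : 0 < modulus n h v vβ) (hc₀ : 0 < c₀')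
    (hsc0 : c₀' * A * (40 * modulus n h v vβ) = (P.r 0 : ℤ) * D) (hsc1 : c₁' * A * (40 * modulus n h v vβ) = (P.r 1 : ℤ) * D) (b₀ : Fin 2 → ℕ)
    (hxL1 : 40 * modulus n h v vβ * n * (20 * (P.r 0 : ℤ) - (b₀ 0 : ℕ) + 1) + (P.r 0 : ℤ) * n +
      (P.r 0 : ℤ) * (|v| * ((shearUnit n h : ℤ) * ((qy n ℓ h v T aW bL : ℕ) + 800 * T + 1))) ≤ (P.r 0 : ℤ) * (modulus n h v vβ * (799 * n - 800 * T)))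
    (hxL3 : (P.r 1 : ℤ) * ((shearUnit n h : ℤ) * ((qy n ℓ h v T aW bL : ℕ) + 800 * T + 1)) + 40 * modulus n h v vβ ≤ 40 * modulus n h v vβ * (b₀ 1 : ℕ))
    {du : MDir} (hd : du.1 = 0) :
    let Bd := bandNw n ℓ h v T n NC (qy n ℓ h v T aW bL) NC (qy n ℓ h v T aW bL) (Wmy n v) (Wpy n v) du
    let lo := dLo du.1 (sgOf du) 0 (Bd.aLo (Bd.N + 1)) (Bd.aHi (Bd.N + 1)) (Bd.bLo (Bd.N + 1)) (Bd.bHi (Bd.N + 1))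
    let hi := dHi du.1 (sgOf du) 0 (Bd.aLo (Bd.N + 1)) (Bd.aHi (Bd.N + 1)) (Bd.bLo (Bd.N + 1)) (Bd.bHi (Bd.N + 1))
    (sgOf du = 1 → 20 * (P.r du.1 : ℤ) - (b₀ du.1 : ℕ) + 1 ≤ rdLo A n h v vβ c₀' c₁' D lo hi du.1 ∧
      rdHi A n h v vβ c₀' c₁' D lo hi du.1 ≤ 20 * (P.r du.1 : ℤ) + (b₀ du.1 : ℕ) - 1) ∧
    (sgOf du = -1 → 20 * (P.r du.1 : ℤ) - (b₀ du.1 : ℕ) + 1 ≤ -rdHi A n h v vβ c₀' c₁' D lo hi du.1 ∧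
      -rdLo A n h v vβ c₀' c₁' D lo hi du.1 ≤ 20 * (P.r du.1 : ℤ) + (b₀ du.1 : ℕ) - 1) ∧
    (-((b₀ (oth du.1) : ℕ) : ℤ) + 1 ≤ rdLo A n h v vβ c₀' c₁' D lo hi (oth du.1) ∧
      rdHi A n h v vβ c₀' c₁' D lo hi (oth du.1) ≤ ((b₀ (oth du.1) : ℕ) : ℤ) - 1) := by
  intro Bd lo hi
  dsimp only [Bd, lo, hi]
  rw [bandNw_x (n := n) (ℓ := ℓ) (h := h) (v := v) (T := T) (aW := aW) (bL := bL) hd, hd, oth_zero']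
  obtain ⟨haLo, haHi, hbLo, hbHi, -, -, -, -, hN⟩ := cornersX (n := n) (h := h) (v := v) (ℓ := ℓ) (T := T) (aW := aW) (bL := bL) 800
  set R := xPrmWw n ℓ h T n NC (qy n ℓ h v T aW bL) (qy n ℓ h v T aW bL) with hR
  rw [hN]
  norm_num only
  set X₁ : ℤ := (qy n ℓ h v T aW bL : ℕ) + 800 * T with hX₁
  set C : ℤ := |v| * ((shearUnit n h : ℤ) * (X₁ + 1)) with hC
  have hΔ : (0 : ℤ) < modulus n h v vβ := hm
  have hT0 : (0 : ℤ) ≤ T := by positivity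
  have hn1 : (1 : ℤ) ≤ n := by exact_mod_cast hn
  have hq0 : (0 : ℤ) ≤ (qy n ℓ h v T aW bL : ℕ) := by positivity
  have hU : (0 : ℤ) ≤ (shearUnit n h : ℤ) := by positivity
  have hr0 : (1 : ℤ) ≤ P.r 0 := by exact_mod_cast P.one_le_r 0
  have hr1 : (1 : ℤ) ≤ P.r 1 := by exact_mod_cast P.one_le_r 1
  have hrn : (1 : ℤ) ≤ (P.r 0 : ℤ) * n := by nlinarith
  -- the corners of the last core
  have cLo : R.aLo 800 = 799 * (n : ℤ) - 800 * T := by rw [haLo]; ring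
  have cHi : R.aHi 800 = 801 * (n : ℤ) + 800 * T := by rw [haHi]; ring
  have cbL : R.bLo 800 = -X₁ := by rw [hbLo]; push_cast; ring
  have cbH : R.bHi 800 = X₁ := by rw [hbHi]; push_cast; ring
  have hX1 : 0 ≤ X₁ := by positivity
  -- the mixed terms of a box across `±X₁`
  have hMhi : ∀ {a b : ℤ}, |a| ≤ X₁ → |b| ≤ X₁ →
      max (v * ((shearUnit n h : ℤ) * a)) (v * ((shearUnit n h : ℤ) * b + shearUnit n h - 1)) ≤ C := fun ha hb =>
    max_le ((le_abs_self _).trans (mixed_le hn hm ha).1) ((le_abs_self _).trans (mixed_le hn hm hb).2)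
  have hMlo : ∀ {a b : ℤ}, |a| ≤ X₁ → |b| ≤ X₁ →
      -C ≤ min (v * ((shearUnit n h : ℤ) * a)) (v * ((shearUnit n h : ℤ) * b + shearUnit n h - 1)) := fun ha hb =>
    le_min ((neg_le_neg (mixed_le hn hm ha).1).trans (neg_abs_le _)) ((neg_le_neg (mixed_le hn hm hb).2).trans (neg_abs_le _))
  have aX : |X₁| ≤ X₁ := (abs_of_nonneg hX1).le
  have anX : |(-X₁)| ≤ X₁ := by rw [abs_neg]; exact aX
  rcases sgOf_sign du with hs | hs <;> rw [hs]
  · obtain ⟨e0, e1, e0', e1'⟩ := dLoHi_one_zero 0 (R.aLo 800) (R.aHi 800) (R.bLo 800) (R.bHi 800)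
    rw [oth_zero'] at e1 e1'
    set lo' := dLo 0 1 0 (R.aLo 800) (R.aHi 800) (R.bLo 800) (R.bHi 800) with hlo'
    set hi' := dHi 0 1 0 (R.aLo 800) (R.aHi 800) (R.bLo 800) (R.bHi 800) with hhi'
    rw [cLo] at e0; rw [cHi] at e0'; rw [cbL] at e1; rw [cbH] at e1'
    refine ⟨fun _ => ⟨?_, ?_⟩, fun h1 => absurd h1 (by norm_num), ?_, ?_⟩
    · refine rdLo_zero_ge hn hA hD hm hc₀ hsc0 ?_
      rw [e0, e1, e1']
      have h1 := mul_le_mul_of_nonneg_left (hMhi anX aX) (by linarith : (0 : ℤ) ≤ P.r 0)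
      linarith [h1, hxL1]
    · refine rdHi_zero_le hn hD hm hc₀ hsc0 ?_
      rw [e0', e1, e1']
      have h1 := mul_le_mul_of_nonneg_left (hMlo anX aX) (by linarith : (0 : ℤ) ≤ P.r 0)
      linarith [h1, hxL1]
    · refine rdLo_one_ge hD hm hsc1 ?_
      rw [e1]
      have h0 := mul_nonneg (mul_nonneg (by linarith : (0 : ℤ) ≤ P.r 1) hU) hX1
      have h0' := mul_nonneg (by linarith : (0 : ℤ) ≤ P.r 1) hU
      linarith [hxL3]
    · refine rdHi_one_le hD hm hsc1 ?_
      rw [e1']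
      linarith [hxL3, hr1]
  · obtain ⟨e0, e1, e0', e1'⟩ := dLoHi_neg_zero 0 (R.aLo 800) (R.aHi 800) (R.bLo 800) (R.bHi 800)
    rw [oth_zero'] at e1 e1'
    set lo' := dLo 0 (-1) 0 (R.aLo 800) (R.aHi 800) (R.bLo 800) (R.bHi 800) with hlo'
    set hi' := dHi 0 (-1) 0 (R.aLo 800) (R.aHi 800) (R.bLo 800) (R.bHi 800) with hhi'
    rw [cHi] at e0; rw [cLo] at e0'; rw [cbH] at e1; rw [cbL, neg_neg] at e1'
    refine ⟨fun h1 => absurd h1 (by norm_num), fun _ => ⟨?_, ?_⟩, ?_, ?_⟩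
    · suffices hh : rdHi A n h v vβ c₀' c₁' D lo' hi' 0 ≤ -(20 * (P.r 0 : ℤ) - (b₀ 0 : ℕ) + 1) by linarith
      refine rdHi_zero_le hn hD hm hc₀ hsc0 ?_
      rw [e0', e1, e1']
      have h1 := mul_le_mul_of_nonneg_left (hMlo anX aX) (by linarith : (0 : ℤ) ≤ P.r 0)
      linarith [h1, hxL1]
    · suffices hh : -(20 * (P.r 0 : ℤ) + (b₀ 0 : ℕ) - 1) ≤ rdLo A n h v vβ c₀' c₁' D lo' hi' 0 by linarith
      refine rdLo_zero_ge hn hA hD hm hc₀ hsc0 ?_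
      rw [e0, e1, e1']
      have h1 := mul_le_mul_of_nonneg_left (hMhi anX aX) (by linarith : (0 : ℤ) ≤ P.r 0)
      linarith [h1, hxL1]
    · refine rdLo_one_ge hD hm hsc1 ?_
      rw [e1]
      have h0 := mul_nonneg (mul_nonneg (by linarith : (0 : ℤ) ≤ P.r 1) hU) hX1
      have h0' := mul_nonneg (by linarith : (0 : ℤ) ≤ P.r 1) hU
      linarith [hxL3]
    · refine rdHi_one_le hD hm hsc1 ?_
      rw [e1']
      linarith [hxL3, hr1]

/-! ## §4 The habitat points of the x-band cores -/

/-- **The habitat point of core `j` of the x-band**: `(σ·j'·n, 0)`, `j' = min j 800`. [this work] -/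
def zBx (n : ℕ) (σ : ℤ) (j : ℕ) : Site 2 := ![σ * ((min j 800 : ℕ) : ℤ) * n, 0]

/-- The coordinates of the habitat point. [folklore] -/
theorem zBx_apply (n : ℕ) (σ : ℤ) (j : ℕ) : zBx n σ j 0 = σ * ((min j 800 : ℕ) : ℤ) * n ∧ zBx n σ j 1 = 0 := ⟨rfl, rfl⟩

/-- **The habitat point of core `j ≤ 800` lies in core `j`** of the x-band. [folklore] -/
theorem zBx_mem {du : MDir} (hd : du.1 = 0) {j : ℕ} (hj1 : 1 ≤ j) (hj : j ≤ (bandNw n ℓ h v T n NC (qy n ℓ h v T aW bL) NC (qy n ℓ h v T aW bL) (Wmy n v) (Wpy n v) du).N + 1) :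
    zBx n (sgOf du) j ∈ (bandNw n ℓ h v T n NC (qy n ℓ h v T aW bL) NC (qy n ℓ h v T aW bL) (Wmy n v) (Wpy n v) du).pcore du.1 (sgOf du) 0 j := by
  have _h := hj1
  rw [bandNw_x (n := n) (ℓ := ℓ) (h := h) (v := v) (T := T) (aW := aW) (bL := bL) hd] at hj ⊢
  obtain ⟨haLo, haHi, hbLo, hbHi, -, -, -, -, hN⟩ := cornersX (n := n) (h := h) (v := v) (ℓ := ℓ) (T := T) (aW := aW) (bL := bL) j
  rw [hN] at hj
  have hjm : (min j 800 : ℕ) = j := min_eq_left hj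
  have hσσ : sgOf du * sgOf du = 1 := by rcases sgOf_sign du with hs | hs <;> simp [hs]
  rw [hd, RunPrm.mem_pcore_iff (sgOf_sign du)]
  simp only [RunPrm.InCore, Pi.zero_apply, sub_zero, oth_zero', (zBx_apply n (sgOf du) j).1, (zBx_apply n (sgOf du) j).2, hjm, mul_zero,
    haLo, haHi, hbLo, hbHi]
  have e : sgOf du * (sgOf du * (j : ℤ) * n) = (j : ℤ) * n := by
    calc sgOf du * (sgOf du * (j : ℤ) * n) = (sgOf du * sgOf du) * ((j : ℤ) * n) := by ring
      _ = (j : ℤ) * n := by rw [hσσ, one_mul]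
  rw [e]
  have hT0 : (0 : ℤ) ≤ T := by positivity
  have hn0 : (0 : ℤ) ≤ n := by positivity
  have hq0 : (0 : ℤ) ≤ (qy n ℓ h v T aW bL : ℕ) := by positivity
  have hj0 : (0 : ℤ) ≤ j := by positivity
  refine ⟨by nlinarith, by nlinarith, by nlinarith, by nlinarith⟩

/-- **The habitat points are within `800·n` of the origin** (in `ℓ¹`). [folklore] -/
theorem zBx_l1 (σ : ℤ) (hσ : σ = 1 ∨ σ = -1) (j : ℕ) : ((zBx n σ j) 0).natAbs + ((zBx n σ j) 1).natAbs ≤ 800 * n := by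
  rw [(zBx_apply n σ j).1, (zBx_apply n σ j).2]
  have hm : (min j 800 : ℕ) ≤ 800 := min_le_right _ _
  have h1 : (σ * ((min j 800 : ℕ) : ℤ) * n).natAbs = (min j 800 : ℕ) * n := by
    rw [Int.natAbs_mul, Int.natAbs_mul, Int.natAbs_natCast, Int.natAbs_natCast]
    rcases hσ with rfl | rfl <;> simp
  rw [h1]; simp only [Int.natAbs_zero, add_zero]
  exact Nat.mul_le_mul_right _ hm

/-- **The habitat points of the x-band read inside the rooms with one unit of margin**, either sign, under the band floors.
[cite: KozmaNitzan2024, §4 p. 26 (H_{v,x})] -/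
theorem roomsZx (hn : 1 ≤ n) (hA : 0 < A) (hD : 0 < D) (hm : 0 < modulus n h v vβ) (hc₀ : 0 < c₀')
    (hsc0 : c₀' * A * (40 * modulus n h v vβ) = (P.r 0 : ℤ) * D) (hsc1 : c₁' * A * (40 * modulus n h v vβ) = (P.r 1 : ℤ) * D)
    (hbx1 : modulus n h v vβ * (2 * n + 800 * T) + |v| * ((shearUnit n h : ℤ) * ((qy n ℓ h v T aW bL : ℕ) + 800 * T + (3 * (n * ℓ) / shearUnit n h + 1 : ℕ) + 1))
      + 3 * modulus n h v vβ * n ≤ 40 * 5 * modulus n h v vβ * n)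
    (hbx2 : modulus n h v vβ * (801 * n + 800 * T) + |v| * ((shearUnit n h : ℤ) * ((qy n ℓ h v T aW bL : ℕ) + 800 * T + (3 * (n * ℓ) / shearUnit n h + 1 : ℕ) + 1))
      + 3 * modulus n h v vβ * n ≤ 40 * 22 * modulus n h v vβ * n)
    (hbx3 : (shearUnit n h : ℤ) * ((qy n ℓ h v T aW bL : ℕ) + 800 * T + (3 * (n * ℓ) / shearUnit n h + 1 : ℕ) + 1) + 2 * modulus n h v vβ ≤
      40 * 2 * modulus n h v vβ)
    {du : MDir} (hd : du.1 = 0) (j : ℕ) :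
    (sgOf du = 1 → -(5 * (P.r du.1 : ℤ)) + 1 ≤ rdLo A n h v vβ c₀' c₁' D (zBx n (sgOf du) j) (zBx n (sgOf du) j) du.1 ∧
      rdHi A n h v vβ c₀' c₁' D (zBx n (sgOf du) j) (zBx n (sgOf du) j) du.1 ≤ 22 * (P.r du.1 : ℤ) - 1) ∧
    (sgOf du = -1 → -(5 * (P.r du.1 : ℤ)) + 1 ≤ -rdHi A n h v vβ c₀' c₁' D (zBx n (sgOf du) j) (zBx n (sgOf du) j) du.1 ∧
      -rdLo A n h v vβ c₀' c₁' D (zBx n (sgOf du) j) (zBx n (sgOf du) j) du.1 ≤ 22 * (P.r du.1 : ℤ) - 1) ∧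
    (-(2 * (P.r (oth du.1) : ℤ)) + 1 ≤ rdLo A n h v vβ c₀' c₁' D (zBx n (sgOf du) j) (zBx n (sgOf du) j) (oth du.1) ∧
      rdHi A n h v vβ c₀' c₁' D (zBx n (sgOf du) j) (zBx n (sgOf du) j) (oth du.1) ≤ 2 * (P.r (oth du.1) : ℤ) - 1) := by
  rw [hd, oth_zero']
  obtain ⟨e0, e1⟩ := zBx_apply n (sgOf du) j
  set X₁ : ℤ := (qy n ℓ h v T aW bL : ℕ) + 800 * T + (3 * (n * ℓ) / shearUnit n h + 1 : ℕ) with hX₁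
  have hX1 : 0 ≤ X₁ := by positivity
  have hΔ : (0 : ℤ) < modulus n h v vβ := hm
  have hn0 : (0 : ℤ) ≤ n := by positivity
  have hU : (0 : ℤ) ≤ (shearUnit n h : ℤ) := by positivity
  have hv0 : (0 : ℤ) ≤ |v| := abs_nonneg v
  have hjm : ((min j 800 : ℕ) : ℤ) ≤ 800 := by exact_mod_cast min_le_right j 800
  have hj0 : (0 : ℤ) ≤ ((min j 800 : ℕ) : ℤ) := by positivity
  have hT0 : (0 : ℤ) ≤ T := by positivity
  -- the point budgets follow from the band floors
  have hC : |v| * ((shearUnit n h : ℤ) * (0 + 1)) ≤ |v| * ((shearUnit n h : ℤ) * (X₁ + 1)) :=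
    mul_le_mul_of_nonneg_left (mul_le_mul_of_nonneg_left (by linarith) hU) hv0
  have pb1 : modulus n h v vβ * 0 + |v| * ((shearUnit n h : ℤ) * (0 + 1)) + 3 * modulus n h v vβ * n ≤ 40 * 5 * modulus n h v vβ * n := by
    nlinarith [hbx1, mul_nonneg hΔ.le (show (0:ℤ) ≤ 2 * n + 800 * T by positivity)]
  have pb2 : modulus n h v vβ * (800 * n) + |v| * ((shearUnit n h : ℤ) * (0 + 1)) + 3 * modulus n h v vβ * n ≤ 40 * 22 * modulus n h v vβ * n := by
    nlinarith [hbx2, mul_nonneg hΔ.le (show (0:ℤ) ≤ n + 800 * T by positivity)]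
  have pb3 : (shearUnit n h : ℤ) * (0 + 1) + 2 * modulus n h v vβ ≤ 40 * 2 * modulus n h v vβ := by nlinarith [hbx3]
  have pb3' : (shearUnit n h : ℤ) * 0 + 2 * modulus n h v vβ ≤ 40 * 2 * modulus n h v vβ := by nlinarith [hbx3]
  have a1 : |zBx n (sgOf du) j 1| ≤ 0 := by rw [e1]; simp
  have hmn : ((min j 800 : ℕ) : ℤ) * n ≤ 800 * n := mul_le_mul_of_nonneg_right hjm hn0
  have hmn0 : 0 ≤ ((min j 800 : ℕ) : ℤ) * n := mul_nonneg hj0 hn0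
  rcases sgOf_sign du with hs | hs
  · have g0 : zBx n (sgOf du) j 0 = ((min j 800 : ℕ) : ℤ) * n := by rw [e0, hs, one_mul]
    have k1 := readLo0_of_budget (c₁' := c₁') (D := D) hn hA hD hm hc₀ hsc0 (lo := zBx n (sgOf du) j) (hi := zBx n (sgOf du) j) (m := 5) (B := 0)
      (X₁ := 0) (by rw [g0]; linarith) a1 a1 pb1
    have k2 := readHi0_of_budget (A := A) (c₁' := c₁') (D := D) hn hD hm hc₀ hsc0 (lo := zBx n (sgOf du) j) (hi := zBx n (sgOf du) j) (m := 22)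
      (B := 800 * n) (X₁ := 0) (by rw [g0]; exact hmn) a1 a1 pb2
    have k3 := readLo1_of_budget (A := A) (c₀' := c₀') (D := D) hD hm hsc1 (lo := zBx n (sgOf du) j) (hi := zBx n (sgOf du) j) (m := 2) (B := 0)
      (by rw [e1, neg_zero]) pb3'
    have k4 := readHi1_of_budget (A := A) (c₀' := c₀') (D := D) hD hm hsc1 (lo := zBx n (sgOf du) j) (hi := zBx n (sgOf du) j) (m := 2) (B := 0)
      (by rw [e1]) pb3
    exact ⟨fun _ => ⟨by linarith, by linarith⟩, fun h1 => absurd (hs.symm.trans h1) (by norm_num), by linarith, by linarith⟩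
  · have g0 : zBx n (sgOf du) j 0 = -(((min j 800 : ℕ) : ℤ) * n) := by rw [e0, hs]; ring
    have k1 := readHi0_of_budget (A := A) (c₁' := c₁') (D := D) hn hD hm hc₀ hsc0 (lo := zBx n (sgOf du) j) (hi := zBx n (sgOf du) j) (m := 5)
      (B := 0) (X₁ := 0) (by rw [g0]; linarith) a1 a1 pb1
    have k2 := readLo0_of_budget (c₁' := c₁') (D := D) hn hA hD hm hc₀ hsc0 (lo := zBx n (sgOf du) j) (hi := zBx n (sgOf du) j) (m := 22)
      (B := 800 * n) (X₁ := 0) (by rw [g0]; linarith) a1 a1 pb2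
    have k3 := readLo1_of_budget (A := A) (c₀' := c₀') (D := D) hD hm hsc1 (lo := zBx n (sgOf du) j) (hi := zBx n (sgOf du) j) (m := 2) (B := 0)
      (by rw [e1, neg_zero]) pb3'
    have k4 := readHi1_of_budget (A := A) (c₀' := c₀') (D := D) hD hm hsc1 (lo := zBx n (sgOf du) j) (hi := zBx n (sgOf du) j) (m := 2) (B := 0)
      (by rw [e1]) pb3
    exact ⟨fun h1 => absurd (hs.symm.trans h1) (by norm_num), fun _ => ⟨by linarith, by linarith⟩, by linarith, by linarith⟩

end XBand

end CorrRec

end Skelφ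

end Transplant

end Summit.CriticalPhenomena.PercolationContinuityZ3.Theorems

end
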